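/-
Origin: written from primary sources — A. Weil, *Sur certains groupes d'opérateurs unitaires*, Acta Math. 111 (1964) Chap. III
n° 41, Lemme 5 p. 194, Théorème 6 p. 193; S. Gelbart, J. Rogawski, Invent. Math. 105 (1991) §3.1 Prop. 3.1.1 p. 455, Remark
p. 457 L4–13; J. Getz, H. Hahn, *An introduction to automorphic representations* (2024) §2.2 (adelic points), §2.6 (rational points).
Adapted: no. This file reads the Weil majorants (`UnitaryDualPairSeesawCMLines{,Conj}Majorants`) and the rational `Θ`-invariance
(`UnitaryDualPairSeesawCMLinesRational`) of the four CM line representations `cmLineRepFin₀/₁`, `cmConjLineRepFin₀/₁` through a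
FRAME `U(H)(𝔸) ≅ U(diag dV)(𝔸)` (`cmFrameEquiv`) restricted to any subgroup `K ≤ U(H)(𝔸)` — the literal shape of the Hodge-CM
period packet's line data. Kernel only; no records; nothing cited as a hypothesis.
r3 2026-08-19 (CITATION LINT `lint.literature-cited-only`, gate reload 20:41Z; proposal p194973 of r2 ea8a5da2e83f bounced on its seven
folklore-tagged helpers): §§1–2 — the eight `[cite: …]` theorems of r2 (author `prover-pub-hodgecm-mc-discharge-4-g9-0`) — are
VERBATIM; the frame-continuity helper of §1 is inlined at its four use sites (no declaration); former §3 (continuity of the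
DEFAULT η-split: `continuous_cmPlaneTorus`, `continuous_cmConjPlaneTorus`, `continuous_cmEta₀`, `continuous_cmEta₁_comp_snd`,
`continuous_cmConjEta₀`, `continuous_cmConjEta₁_comp_snd` — our own helper lemmas, no published statement) is REMOVED from
`Literature/` and lives with its only consumer, the Hodge-CM package module `HodgeCM/Model/ArchSideOf.lean` (notice option (c):
cited statements in `Literature/`, derived helpers on the `Summits`/package side). Re-cut by the consumer seat
`planner-pub-hodgecm-mc-period-1-g10-0`; no statement of §§1–2 changed.
-/
import Literature.NumberTheory.GelbartRogawski1991.UnitaryDualPairSeesawCMLinesConjMajorants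
import Literature.NumberTheory.GelbartRogawski1991.UnitaryDualPairSeesawCMLinesRational
import HarnessLib

-- buildfix G11b-3 recipe (LEDGER B13-1/B13-3): elaborate sequentially so the trailing `attribute [implicit_reducible]`
-- block (reducibilityCoreExt is keyed to the async environment branch) is in force at `.olean` export.
set_option Elab.async false

/-!
# The CM line representations through a frame: `majorants` and `theta_rat` on `K × ker N_{L/L⁺}`, `K ≤ U(H)(𝔸_{L⁺})`

For a hermitian matrix `H` with a frame `g ∈ GL_N(L)`, `ᵗḡ H g = diag(dV)` (`cmFrameEquiv L g H dV hg : U(H)(𝔸) ≃ₜ* U(diag dV)(𝔸)`,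
`x ↦ g_𝔸⁻¹ x g_𝔸`), and any subgroup `K ≤ U(H)(𝔸_{L⁺})`, the line representation of line `k` READ ON `K × ker N_{L/L⁺}` is
`(cmLineRepFin_k η_k).comp ((cmFrameEquiv ∘ K.subtype) × id)` (`k = 0, 1`; `cmConjLineRepFin` for `k = 2, 3`) — the `ω := lineRepOf k`
of `HodgeCM/Model/ArchSideTerm.lean` at `H := V.Hm`, `K := regimeSubgroup L V.Hm`.  This file supplies, for these framed
representations, the two Weil fields of the period packet's `WeilPairData`:

* §1 **`hasThetaMajorants_cmLineRepFin₀/₁_framed_of_signs`**, **`hasThetaMajorants_cmConjLineRepFin₀/₁_framed_of_signs`** — the field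
  `majorants : HasThetaMajorants fun p φ => ω p φ` from the sign facts `(ι₁, h₁V, h₁W, hV)` and `Continuous ↑η_k`
  (`…_of_signs` ∘ `HasThetaMajorants.comp` along the continuous `cmFrameEquiv ∘ Subtype.val × id`) [Weil1964, Lemme 5];
* §2 **`forall_cmLineRepFin₀/₁_framed_mem_thetaStabilizerEnd`**, **`forall_cmConjLineRepFin₀/₁_framed_mem_thetaStabilizerEnd`** — the
  field `theta_rat : ∀ γ ∈ Γ, ∀ t ∈ relNormOneRat, ω (γ, t) ∈ thetaStabilizerEnd` for any `Γ ≤ K` consisting of RATIONAL points of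
  `U(H)` (`hΓ : γ ∈ Γ → ↑γ ∈ adelicUnitaryRat L H`; frames respect rational points: `cmFrameEquiv_mem_range_toAdelic`) and `η_k`
  trivial at rational points [Weil1964, Thm 6; GelbartRogawski1991, Remark p. 457];
* (r3) the hypothesis `Continuous ↑η_k` of §1 for the DEFAULT η-split (`UnitaryDualPairSeesawCMLines` §2) is discharged by the
  consumer (`HodgeCM/Model/ArchSideOf.lean`, lemmas `continuous_cmEta₀` & co.); its `η_k`-rat hypothesis of §2 is
  `UnitaryDualPairSeesawCMLinesRational` §3 (`cmEta₀/₁_eq_one_of_rat`, `cmConjEta₀/₁_eq_one_of_rat`).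

Nothing here is a claim of the manuscripts under adjudication: kernel analysis over the tree's constructed objects.
-/

set_option autoImplicit false

noncomputable section

open scoped Matrix Kronecker
open NumberField
open Literature.RepresentationTheory
open Literature.NumberTheory.Automorphic
open Literature.NumberTheory.Automorphic.UnitaryGroup
open Literature.NumberTheory.Weil1964

namespace Literature.NumberTheory.GelbartRogawski1991

namespace UnitaryDualPair

section Framed

variable (L : Type) [Field L] [NumberField L] [IsCMField L] {N n n₁ : ℕ}
  (e : Fin N × Fin 2 ≃ Fin n) (e₁ : Fin N × Fin 1 ≃ Fin n₁)
variable (dV : Fin N → L) (hdV : ∀ i, IsCMField.complexConj L (dV i) = dV i) (hdV0 : ∀ i, dV i ≠ 0)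
variable (a : Fin 2 → L) (ha : ∀ i, IsCMField.complexConj L (a i) = a i) (ha0 : ∀ i, a i ≠ 0)
variable (b : Fin 2 → L) (hb : ∀ i, IsCMField.complexConj L (b i) = b i) (hb0 : ∀ i, b i ≠ 0) (g₀ : GL (Fin 2) L)
  (hg₀ : ((g₀ : Matrix (Fin 2) (Fin 2) L).map (IsCMField.complexConj L : L →+* L))ᵀ * Matrix.diagonal a *
    (g₀ : Matrix (Fin 2) (Fin 2) L) = Matrix.diagonal b)
variable (hGR : (cmSplittingDatum L e dV hdV hdV0 a ha ha0).CompatibleSplitting)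
  (hGRa₀ : (cmSplittingDatum L e₁ dV hdV hdV0 (lineVec L (a 0)) (fun _ => ha 0) (fun _ => ha0 0)).CompatibleSplitting)
  (hGRa₁ : (cmSplittingDatum L e₁ dV hdV hdV0 (lineVec L (a 1)) (fun _ => ha 1) (fun _ => ha0 1)).CompatibleSplitting)
  (hGRb₀ : (cmSplittingDatum L e₁ dV hdV hdV0 (lineVec L (b 0)) (fun _ => hb 0) (fun _ => hb0 0)).CompatibleSplitting)
  (hGRb₁ : (cmSplittingDatum L e₁ dV hdV hdV0 (lineVec L (b 1)) (fun _ => hb 1) (fun _ => hb0 1)).CompatibleSplitting)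
  (ηk : CMAdelic L dV × CMAdelicOne L →* ℂˣ)
/- the frame and the subgroup on which the line representation is read -/
variable {H : Matrix (Fin N) (Fin N) L} {g : GL (Fin N) L}
  (hg : ((g : Matrix (Fin N) (Fin N) L).map (cmConjRingHom L))ᵀ * H * (g : Matrix (Fin N) (Fin N) L) = Matrix.diagonal dV)
  (K : Subgroup ↥(adelicUnitaryGroup L H))

/-! ## §1 `majorants` for the framed line representations -/

/-- **Weil majorants for line `k = 0` read on `K × ker N_{L/L⁺}` through the frame**, from the sign facts.
[cite: Weil1964, Chap. III n° 41 Lemme 5 p. 194, Théorème 6 (1) p. 193; GelbartRogawski1991, §3.1 Prop. 3.1.1 p. 455, Remark p. 457] -/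
theorem hasThetaMajorants_cmLineRepFin₀_framed_of_signs (ι₁ : L →+* ℂ)
    (h₁V : ∃ i₀ : Fin N, (∀ i, i ≠ i₀ → 0 < (ι₁ (dV i)).re) ∨ ∀ i, i ≠ i₀ → (ι₁ (dV i)).re < 0)
    (h₁W : (∀ j, 0 < (ι₁ (a j)).re) ∨ ∀ j, (ι₁ (a j)).re < 0)
    (hV : ∀ τ : L →+* ℂ, InfinitePlace.mk τ ≠ InfinitePlace.mk ι₁ →
      (∀ i, 0 < (τ (dV i)).re) ∨ ∀ i, (τ (dV i)).re < 0)
    (hη : Continuous fun p => ((ηk p : ℂˣ) : ℂ)) :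
    HasThetaMajorants fun (p : ↥K × ↥(relNormOneIdeles (↥(maximalRealSubfield L)) L))
      (φ : piSchwartzBruhat (↥(maximalRealSubfield L)) (Fin n₁)) =>
        ((cmLineRepFin₀ L e e₁ dV hdV hdV0 a ha ha0 hGR hGRa₀ hGRa₁ ηk).comp
          ((((cmFrameEquiv L g H dV hg).toMonoidHom.comp K.subtype).prodMap (MonoidHom.id _)))) p φ :=
  (hasThetaMajorants_cmLineRepFin₀_of_signs L e e₁ dV hdV hdV0 a ha ha0 hGR hGRa₀ hGRa₁ ηk ι₁ h₁V h₁W hV hη).comp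
    ((((continuous_cmFrameEquiv L g H dV hg).comp continuous_subtype_val).comp continuous_fst).prodMk continuous_snd)

/-- **Weil majorants for line `k = 1` read on `K × ker N_{L/L⁺}` through the frame**, from the sign facts.
[cite: Weil1964, Chap. III n° 41 Lemme 5 p. 194, Théorème 6 (1) p. 193; GelbartRogawski1991, §3.1 Prop. 3.1.1 p. 455, Remark p. 457] -/
theorem hasThetaMajorants_cmLineRepFin₁_framed_of_signs (ι₁ : L →+* ℂ)
    (h₁V : ∃ i₀ : Fin N, (∀ i, i ≠ i₀ → 0 < (ι₁ (dV i)).re) ∨ ∀ i, i ≠ i₀ → (ι₁ (dV i)).re < 0)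
    (h₁W : (∀ j, 0 < (ι₁ (a j)).re) ∨ ∀ j, (ι₁ (a j)).re < 0)
    (hV : ∀ τ : L →+* ℂ, InfinitePlace.mk τ ≠ InfinitePlace.mk ι₁ →
      (∀ i, 0 < (τ (dV i)).re) ∨ ∀ i, (τ (dV i)).re < 0)
    (hη : Continuous fun p => ((ηk p : ℂˣ) : ℂ)) :
    HasThetaMajorants fun (p : ↥K × ↥(relNormOneIdeles (↥(maximalRealSubfield L)) L))
      (φ : piSchwartzBruhat (↥(maximalRealSubfield L)) (Fin n₁)) =>
        ((cmLineRepFin₁ L e e₁ dV hdV hdV0 a ha ha0 hGR hGRa₀ hGRa₁ ηk).comp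
          ((((cmFrameEquiv L g H dV hg).toMonoidHom.comp K.subtype).prodMap (MonoidHom.id _)))) p φ :=
  (hasThetaMajorants_cmLineRepFin₁_of_signs L e e₁ dV hdV hdV0 a ha ha0 hGR hGRa₀ hGRa₁ ηk ι₁ h₁V h₁W hV hη).comp
    ((((continuous_cmFrameEquiv L g H dV hg).comp continuous_subtype_val).comp continuous_fst).prodMk continuous_snd)

/-- **Weil majorants for line `k = 2` (`cmConjLineRepFin₀`) read on `K × ker N_{L/L⁺}` through the frame**, from the sign facts of `V`
and of the first plane `diag(a)`. [cite: Weil1964, Chap. III n° 41 Lemme 5 p. 194, Théorème 6 (1) p. 193; GelbartRogawski1991, §3.1 Remark p. 457] -/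
theorem hasThetaMajorants_cmConjLineRepFin₀_framed_of_signs (ι₁ : L →+* ℂ)
    (h₁V : ∃ i₀ : Fin N, (∀ i, i ≠ i₀ → 0 < (ι₁ (dV i)).re) ∨ ∀ i, i ≠ i₀ → (ι₁ (dV i)).re < 0)
    (h₁W : (∀ j, 0 < (ι₁ (a j)).re) ∨ ∀ j, (ι₁ (a j)).re < 0)
    (hV : ∀ τ : L →+* ℂ, InfinitePlace.mk τ ≠ InfinitePlace.mk ι₁ →
      (∀ i, 0 < (τ (dV i)).re) ∨ ∀ i, (τ (dV i)).re < 0)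
    (hη : Continuous fun p => ((ηk p : ℂˣ) : ℂ)) :
    HasThetaMajorants fun (p : ↥K × ↥(relNormOneIdeles (↥(maximalRealSubfield L)) L))
      (φ : piSchwartzBruhat (↥(maximalRealSubfield L)) (Fin n₁)) =>
        ((cmConjLineRepFin₀ L e e₁ dV hdV hdV0 a ha ha0 b hb hb0 g₀ hg₀ hGR hGRb₀ hGRb₁ ηk).comp
          ((((cmFrameEquiv L g H dV hg).toMonoidHom.comp K.subtype).prodMap (MonoidHom.id _)))) p φ :=
  (hasThetaMajorants_cmConjLineRepFin₀_of_signs L e e₁ dV hdV hdV0 a ha ha0 b hb hb0 g₀ hg₀ hGR hGRb₀ hGRb₁ ηk ι₁ h₁V h₁W hV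
      hη).comp ((((continuous_cmFrameEquiv L g H dV hg).comp continuous_subtype_val).comp continuous_fst).prodMk continuous_snd)

/-- **Weil majorants for line `k = 3` (`cmConjLineRepFin₁`) read on `K × ker N_{L/L⁺}` through the frame**, from the sign facts.
[cite: Weil1964, Chap. III n° 41 Lemme 5 p. 194, Théorème 6 (1) p. 193; GelbartRogawski1991, §3.1 Remark p. 457] -/
theorem hasThetaMajorants_cmConjLineRepFin₁_framed_of_signs (ι₁ : L →+* ℂ)
    (h₁V : ∃ i₀ : Fin N, (∀ i, i ≠ i₀ → 0 < (ι₁ (dV i)).re) ∨ ∀ i, i ≠ i₀ → (ι₁ (dV i)).re < 0)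
    (h₁W : (∀ j, 0 < (ι₁ (a j)).re) ∨ ∀ j, (ι₁ (a j)).re < 0)
    (hV : ∀ τ : L →+* ℂ, InfinitePlace.mk τ ≠ InfinitePlace.mk ι₁ →
      (∀ i, 0 < (τ (dV i)).re) ∨ ∀ i, (τ (dV i)).re < 0)
    (hη : Continuous fun p => ((ηk p : ℂˣ) : ℂ)) :
    HasThetaMajorants fun (p : ↥K × ↥(relNormOneIdeles (↥(maximalRealSubfield L)) L))
      (φ : piSchwartzBruhat (↥(maximalRealSubfield L)) (Fin n₁)) =>
        ((cmConjLineRepFin₁ L e e₁ dV hdV hdV0 a ha ha0 b hb hb0 g₀ hg₀ hGR hGRb₀ hGRb₁ ηk).comp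
          ((((cmFrameEquiv L g H dV hg).toMonoidHom.comp K.subtype).prodMap (MonoidHom.id _)))) p φ :=
  (hasThetaMajorants_cmConjLineRepFin₁_of_signs L e e₁ dV hdV hdV0 a ha ha0 b hb hb0 g₀ hg₀ hGR hGRb₀ hGRb₁ ηk ι₁ h₁V h₁W hV
      hη).comp ((((continuous_cmFrameEquiv L g H dV hg).comp continuous_subtype_val).comp continuous_fst).prodMk continuous_snd)

/-! ## §2 `theta_rat` for the framed line representations -/

variable (Γ : Subgroup ↥K) (hΓ : ∀ γ ∈ Γ, ((γ : ↥K) : ↥(adelicUnitaryGroup L H)) ∈ adelicUnitaryRat L H)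
  (hηrat : ∀ v ∈ CMRat L dV, ∀ t ∈ relNormOneRat (↥(maximalRealSubfield L)) L,
    ηk (v, (cmAdelicOneEquivRelNormOne L).symm t) = 1)

include hΓ hηrat in
/-- **`theta_rat` for line `k = 0` read through the frame**: for `γ ∈ Γ` (rational points of `U(H)` inside `K`) and
`t ∈ U(1)_{L/L⁺}(L⁺)`, `ω(γ, t)` fixes `Θ`. [cite: Weil1964, Chap. III n° 41 Thm 6 p. 193; GelbartRogawski1991, §3.1 Remark p. 457 L4–13] -/
theorem forall_cmLineRepFin₀_framed_mem_thetaStabilizerEnd :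
    ∀ γ ∈ Γ, ∀ t ∈ relNormOneRat (↥(maximalRealSubfield L)) L,
      ((cmLineRepFin₀ L e e₁ dV hdV hdV0 a ha ha0 hGR hGRa₀ hGRa₁ ηk).comp
          ((((cmFrameEquiv L g H dV hg).toMonoidHom.comp K.subtype).prodMap (MonoidHom.id _)))) (γ, t) ∈
        thetaStabilizerEnd (↥(maximalRealSubfield L)) (Fin n₁) :=
  fun γ hγ t ht => forall_cmLineRepFin₀_mem_thetaStabilizerEnd L e e₁ dV hdV hdV0 a ha ha0 hGR hGRa₀ hGRa₁ ηk hηrat _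
    (cmFrameEquiv_mem_range_toAdelic L g H dV hg (hΓ γ hγ)) t ht

include hΓ hηrat in
/-- **`theta_rat` for line `k = 1` read through the frame.** [cite: Weil1964, Chap. III n° 41 Thm 6 p. 193; GelbartRogawski1991, §3.1 Remark p. 457 L4–13] -/
theorem forall_cmLineRepFin₁_framed_mem_thetaStabilizerEnd :
    ∀ γ ∈ Γ, ∀ t ∈ relNormOneRat (↥(maximalRealSubfield L)) L,
      ((cmLineRepFin₁ L e e₁ dV hdV hdV0 a ha ha0 hGR hGRa₀ hGRa₁ ηk).comp
          ((((cmFrameEquiv L g H dV hg).toMonoidHom.comp K.subtype).prodMap (MonoidHom.id _)))) (γ, t) ∈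
        thetaStabilizerEnd (↥(maximalRealSubfield L)) (Fin n₁) :=
  fun γ hγ t ht => forall_cmLineRepFin₁_mem_thetaStabilizerEnd L e e₁ dV hdV hdV0 a ha ha0 hGR hGRa₀ hGRa₁ ηk hηrat _
    (cmFrameEquiv_mem_range_toAdelic L g H dV hg (hΓ γ hγ)) t ht

include hΓ hηrat in
/-- **`theta_rat` for line `k = 2` (`cmConjLineRepFin₀`) read through the frame.**
[cite: Weil1964, Chap. III n° 41 Thm 6 p. 193; GelbartRogawski1991, §3.1 Remark p. 457 L4–13] -/
theorem forall_cmConjLineRepFin₀_framed_mem_thetaStabilizerEnd :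
    ∀ γ ∈ Γ, ∀ t ∈ relNormOneRat (↥(maximalRealSubfield L)) L,
      ((cmConjLineRepFin₀ L e e₁ dV hdV hdV0 a ha ha0 b hb hb0 g₀ hg₀ hGR hGRb₀ hGRb₁ ηk).comp
          ((((cmFrameEquiv L g H dV hg).toMonoidHom.comp K.subtype).prodMap (MonoidHom.id _)))) (γ, t) ∈
        thetaStabilizerEnd (↥(maximalRealSubfield L)) (Fin n₁) :=
  fun γ hγ t ht => forall_cmConjLineRepFin₀_mem_thetaStabilizerEnd L e e₁ dV hdV hdV0 a ha ha0 b hb hb0 g₀ hg₀ hGR hGRb₀ hGRb₁ ηk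
    hηrat _ (cmFrameEquiv_mem_range_toAdelic L g H dV hg (hΓ γ hγ)) t ht

include hΓ hηrat in
/-- **`theta_rat` for line `k = 3` (`cmConjLineRepFin₁`) read through the frame.**
[cite: Weil1964, Chap. III n° 41 Thm 6 p. 193; GelbartRogawski1991, §3.1 Remark p. 457 L4–13] -/
theorem forall_cmConjLineRepFin₁_framed_mem_thetaStabilizerEnd :
    ∀ γ ∈ Γ, ∀ t ∈ relNormOneRat (↥(maximalRealSubfield L)) L,
      ((cmConjLineRepFin₁ L e e₁ dV hdV hdV0 a ha ha0 b hb hb0 g₀ hg₀ hGR hGRb₀ hGRb₁ ηk).comp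
          ((((cmFrameEquiv L g H dV hg).toMonoidHom.comp K.subtype).prodMap (MonoidHom.id _)))) (γ, t) ∈
        thetaStabilizerEnd (↥(maximalRealSubfield L)) (Fin n₁) :=
  fun γ hγ t ht => forall_cmConjLineRepFin₁_mem_thetaStabilizerEnd L e e₁ dV hdV hdV0 a ha ha0 b hb hb0 g₀ hg₀ hGR hGRb₀ hGRb₁ ηk
    hηrat _ (cmFrameEquiv_mem_range_toAdelic L g H dV hg (hΓ γ hγ)) t ht

end Framed

/-! ### Build-lane note (ops-buildfix G11b-3 recipe, LEDGER B13-1, 2026-08-21)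
`lean -o` (the hub build lane, never `lean`/the gate check) runs Lean 4.32's library-suggestion indexers
(`Lean.LibrarySuggestions.SymbolFrequency` / `SineQuaNon`, from their `exportEntriesFn`) over the statement of
every local theorem that is not a denied premise; on this family's statements (very large dependent binder
telescopes through the theta-kernel / dual-pair data) that fold runs for tens of minutes to hours and the build
lane kills the job (incident G11b-3, run/shared/lean/ops/buildfix/G11b-3-DOSSIER.md). `isDeniedPremise` skips
`[implicit_reducible]` constants before any fold, and a reducibility status on a *theorem* is inert (Meta never
unfolds `thmInfo`; the kernel ignores the attribute), so the public theorems of this file are tagged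
`[implicit_reducible]` purely to keep them out of that index. Only other effect: they are not offered by
`+suggestions` premise selectors. No statement or proof is changed; superseded if the operator lands a
deny-list form (`HarnessLib.PremiseIndex`). -/
set_option allowUnsafeReducibility true in
attribute [implicit_reducible]
  hasThetaMajorants_cmLineRepFin₀_framed_of_signs hasThetaMajorants_cmLineRepFin₁_framed_of_signs
  hasThetaMajorants_cmConjLineRepFin₀_framed_of_signs
  hasThetaMajorants_cmConjLineRepFin₁_framed_of_signs
  forall_cmLineRepFin₀_framed_mem_thetaStabilizerEnd
  forall_cmLineRepFin₁_framed_mem_thetaStabilizerEnd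
  forall_cmConjLineRepFin₀_framed_mem_thetaStabilizerEnd
  forall_cmConjLineRepFin₁_framed_mem_thetaStabilizerEnd

end UnitaryDualPair

end Literature.NumberTheory.GelbartRogawski1991

end
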